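import Mathlib.FieldTheory.KrullTopology
import Mathlib.RingTheory.Valuation.RamificationGroup
import Literature.IUT.HodgeTheaters.GlobalFrobenioidsModel
import Literature.AnabelianGeometry.AbsoluteAnabelian.AbsAnabFundamentalGroups
import HarnessLib

/-!
# [IUTchI] Example 5.1 (iv): `BirationalData` at the PRINT-LEVEL pair — any profinite `Π` mapping
# continuously to `G_F` (e.g. an extension `1 → Δ → Π → G → 1` with number-field base `F_mod`),
# acting on `F̄ˣ` through `Π → G_F`, with decomposition groups the PREIMAGES of those of `G_F`
# (NV-L5, proof-only additive companion of `BirationalDataNonVacuity.lean`)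

S. Mochizuki, *Inter-universal Teichmüller theory I*, §5, Example 5.1 (i) p. 123 and (iv) p. 126, kurims
manuscript (May 2020) [claim: Mochizuki2012, status: disputed].  (i) p. 123: "one may construct
group-theoretically from `π₁(†𝒟^⊚)` … a profinite group corresponding to `C_{F_mod}` … which contains
`π₁(†𝒟^⊚)` as an open subgroup; write `†𝒟^⊛` for `ℬ(−)⁰` of this profinite group".  (iv) p. 126: the
pair "`π₁(†𝒟^⊛) ↷ 𝒪̃^⊛×`", "`𝒪^×(A^birat)` … the multiplicative group of nonzero elements of the number
field", the submonoids "`𝒪^⊿_𝔭` … integral elements … with respect to the valuation determined by `𝔭`",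
and "a closed subgroup [well-defined up to conjugation] `Π_{𝔭₀} ⊆ π₁(†𝒟^⊛)` by considering the elements
… that fix the submonoid `𝒪^⊿_𝔭`, for some system of `𝔭`'s lying over `𝔭₀` … simply the decomposition
group associated to some `v ∈ 𝕍_mod`.  In particular, … `𝔭₀` is nonarchimedean if and only if the
`p`-cohomological dimension of `Π_{𝔭₀}` is equal to `2 + 1 = 3` for infinitely many prime numbers `p`".

So in print `π₁(†𝒟^⊛)` is an isomorph of the ARITHMETIC fundamental group `Π_{C_{F_mod}}`, acting on
`𝒪̃^⊛× = F̄_mod^×` THROUGH its quotient `Π_{C_{F_mod}} ↠ G_{F_mod}`, and `Π_{𝔭₀}` is the PREIMAGE of a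
decomposition group `D_v ⊆ G_{F_mod}` (whence `cd_p = 2 + 1`).  The sibling file
`BirationalDataNonVacuity.lean` (abc-iut-w4-d068, NV-L5 row `BirationalData`) inhabits the interface
`Literature.IUT.HodgeTheaters.BirationalData G` at the Galois QUOTIENT `G := G_F`.  This PROOF-ONLY file
(0 `def`s, nothing registered) records the print-level shape: for EVERY profinite `Π` with a continuous
homomorphism `aug : Π → G_F` (`F` any field of characteristic zero; `G_F` = the tree's `absoluteGaloisGrp F`):

* `exists_decompIsStabilizer_of_continuousMonoidHom` — `BirationalData Π` is inhabited by `𝒪̃^⊛× := F̄ˣ`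
  with `Π` acting through `aug` (stabilisers open: preimages of Krull-open stabilisers), primes `𝔭 :=`
  valuation rings of `F̄` ("systems of `𝔭`'s"), `𝒪^⊿_𝔭 := F̄ˣ ∩ 𝒪_𝔭`, `𝔭₀ := 𝔭 ∩ F`, and
  `Π_{𝔭₀} := aug⁻¹(Stab_{G_F}(𝔭))` for a chosen `𝔭` over `𝔭₀` — the PREIMAGE of the decomposition group
  — AT WHICH the typed predicate `DecompIsStabilizer` ("`Π_{𝔭₀}` = the elements fixing `𝒪^⊿_𝔭` for some
  `𝔭` over `𝔭₀`") is a THEOREM, and whose module is `F̄ˣ` on the nose;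
* `exists_decompIsStabilizer_of_nFBase` — the same over ANY extension `E : FundamentalExtension`
  (`1 → Δ → Π → G → 1`, abc-iut-L4-t1) carrying a number-field base `B : E.NFBase` (`G ≅ G_F`,
  abc-iut-L4-t4): `BirationalData E.arith` is inhabited with `DecompIsStabilizer` and module
  `(F̄)ˣ` for `F := B.F` — i.e. exactly the shape "`Π ↠ G_{F_mod} ↷ F̄_mod^×`" of p. 126 (the intended
  `Π = Π_{C_{F_mod}}` is one such `E`; `FundamentalExtensionBaseNonVacuity.lean` shows such `E` exist).
  HONEST LABEL `_model`, same two said simplifications as the sibling: no archimedean primes (valuation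
  rings only; `⊤` is the non-proper index), `𝔭₀` ranges over valuation rings of `F` lying under one of `F̄`.

Nothing of the series is asserted; "`Π` arises from `C_{F_mod}`" is NOT claimed (that is what the
`*Origin` predicates of the anabelian layer add); no side is taken on [IUTchIII] Cor. 3.12; instantiated
≠ endorsed.
-/

noncomputable section

namespace Literature.IUT.HodgeTheaters

namespace BirationalData

open scoped Pointwise
open Literature.AnabelianGeometry.AbsoluteAnabelian (absoluteGaloisGrp FundamentalExtension)

universe u

variable (F : Type u) [Field F] [CharZero F]

/-- For a valuation ring `𝒪 ⊆ F̄` and `σ ∈ G_F`: `σ • 𝒪 = 𝒪` iff `σ` preserves membership in `𝒪` of UNITS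
of `F̄` (every nonzero element is a unit, and `0 ∈ 𝒪`). [folklore] -/
private theorem smul_valuationSubring_eq_iff_units (A : ValuationSubring (AlgebraicClosure F))
    (σ : absoluteGaloisGrp F) :
    σ • A = A ↔ ∀ x : (AlgebraicClosure F)ˣ,
      (x : AlgebraicClosure F) ∈ A ↔ σ • (x : AlgebraicClosure F) ∈ A := by
  constructor
  · intro h x
    conv_rhs => rw [← h]
    exact ValuationSubring.smul_mem_pointwise_smul_iff.symm
  · intro h
    ext y
    rw [ValuationSubring.mem_pointwise_smul_iff_inv_smul_mem]
    by_cases hy : y = 0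
    · subst hy
      simp
    · have hy' : σ⁻¹ • y ≠ 0 := by rwa [Ne, smul_eq_zero_iff_eq]
      have hx := h (Units.mk0 (σ⁻¹ • y) hy')
      simp only [Units.val_mk0, smul_inv_smul] at hx
      exact hx

/-- **NV-L5 `BirationalData` at the print-level pair (`_model`).**  For a field `F` of characteristic
zero and ANY profinite group `Π` with a continuous homomorphism `aug : Π → G_F`, the interface of [IUTchI]
Ex. 5.1 (iv) over `Π` is inhabited by `𝒪̃^⊛× := F̄ˣ` with `Π` acting through `aug`, primes `𝔭 :=`
valuation rings of `F̄` with `𝒪^⊿_𝔭 := F̄ˣ ∩ 𝒪_𝔭`, `𝔭₀ := 𝔭 ∩ F`, and `Π_{𝔭₀} := aug⁻¹(Stab_{G_F}(𝔭))`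
(the PREIMAGE of the decomposition group of a chosen `𝔭` over `𝔭₀`); AT THIS DATUM the typed predicate
`DecompIsStabilizer` holds, the module is `F̄ˣ` on the nose, and every `Π_{𝔭₀}` is such a preimage.
([IUTchI] Ex 5.1 (iv) p.126) [claim: Mochizuki2012, status: disputed] -/
theorem exists_decompIsStabilizer_of_continuousMonoidHom (P : ProfiniteGrp.{u})
    (aug : P →ₜ* absoluteGaloisGrp F) :
    ∃ β : BirationalData P, β.DecompIsStabilizer ∧ Nonempty (β.Otilde ≃* (AlgebraicClosure F)ˣ) ∧
      ∀ p0 : β.PrimeIdx0, ∃ A : ValuationSubring (AlgebraicClosure F),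
        β.decomp p0 = (MulAction.stabilizer (absoluteGaloisGrp F) A).comap aug.toMonoidHom := by
  letI actG : MulDistribMulAction (absoluteGaloisGrp F) (AlgebraicClosure F)ˣ :=
    Units.mulDistribMulActionRight
  letI actP : MulDistribMulAction P (AlgebraicClosure F)ˣ :=
    MulDistribMulAction.compHom _ aug.toMonoidHom
  -- the `Π`-stabiliser of a unit is the preimage of its (Krull-open) `G_F`-stabiliser
  have hstab : ∀ u : (AlgebraicClosure F)ˣ,
      (MulAction.stabilizer P u : Set P) =
        aug ⁻¹' (MulAction.stabilizer (Field.absoluteGaloisGroup F) (u : AlgebraicClosure F)) := by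
    intro u
    ext g
    simp only [SetLike.mem_coe, MulAction.mem_stabilizer_iff, Set.mem_preimage, Units.ext_iff]
    rfl
  refine ⟨{ Otilde := (AlgebraicClosure F)ˣ
            otildeAction := actP
            isOpen_stabilizer := fun u => by
              rw [hstab]
              exact (stabilizer_isOpen_of_isIntegral (K := F) (L := AlgebraicClosure F)
                (u : AlgebraicClosure F)).preimage aug.continuous
            PrimeIdx := ValuationSubring (AlgebraicClosure F)
            Oint := fun A => A.toSubring.toSubmonoid.comap (Units.coeHom (AlgebraicClosure F))
            PrimeIdx0 := {A₀ : ValuationSubring F //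
              ∃ A : ValuationSubring (AlgebraicClosure F), A.comap (algebraMap F (AlgebraicClosure F)) = A₀}
            over := fun A => ⟨A.comap (algebraMap F (AlgebraicClosure F)), A, rfl⟩
            decomp := fun A₀ =>
              (MulAction.stabilizer (absoluteGaloisGrp F) (Classical.choose A₀.2)).comap aug.toMonoidHom
            IsNonarch := fun A₀ => A₀.1 ≠ ⊤ }, ⟨fun A₀ => ?_⟩, ⟨MulEquiv.refl _⟩, fun A₀ => ⟨_, rfl⟩⟩
  refine ⟨Classical.choose A₀.2, Subtype.ext (Classical.choose_spec A₀.2), fun g => ?_⟩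
  rw [Subgroup.mem_comap, MulAction.mem_stabilizer_iff, ContinuousMonoidHom.coe_toMonoidHom,
    smul_valuationSubring_eq_iff_units]
  rfl

/-- **The print-level pair over an extension with number-field base.**  For every extension
`E : 1 → Δ → Π → G → 1` (abc-iut-L4-t1's `FundamentalExtension`) carrying a number-field base
`B : E.NFBase` (`G ≅ G_F`, `F := B.F` playing `F_mod`), the interface `BirationalData Π` of [IUTchI]
Ex. 5.1 (iv) — "`π₁(†𝒟^⊛) ↷ 𝒪̃^⊛×`" with `π₁(†𝒟^⊛)` an extension of `G_{F_mod}` (Ex. 5.1 (i) p. 123) —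
is inhabited by `F̄ˣ` with `Π` acting through `Π ↠ G ≅ G_F`, satisfying the typed description
`DecompIsStabilizer` of the decomposition groups `Π_{𝔭₀}` (preimages of the `D_v ⊆ G_F`), with module
`F̄ˣ` on the nose.  "`Π` arises from `C_{F_mod}`" is NOT claimed.
([IUTchI] Ex 5.1 (iv) p.126) [claim: Mochizuki2012, status: disputed] -/
theorem exists_decompIsStabilizer_of_nFBase (E : FundamentalExtension.{u}) (B : E.NFBase) :
    ∃ β : BirationalData E.arith, β.DecompIsStabilizer ∧
      Nonempty (β.Otilde ≃* (AlgebraicClosure B.F)ˣ) := by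
  haveI : CharZero B.F := inferInstance
  -- `Π ↠ G ≅ G_F`, as a continuous homomorphism into the tree's `absoluteGaloisGrp`
  let aug : E.arith →ₜ* absoluteGaloisGrp B.F :=
    { toMonoidHom := B.galIso.toMulEquiv.toMonoidHom.comp E.aug.toMonoidHom
      continuous_toFun := B.galIso.toHomeomorph.continuous.comp E.aug.continuous }
  obtain ⟨β, hβ, hO, -⟩ := exists_decompIsStabilizer_of_continuousMonoidHom B.F E.arith aug
  exact ⟨β, hβ, hO⟩

/-- Instance on closed terms: over the (degenerate, `Δ = 1`) extension `G_ℚ = G_ℚ` with base `ℚ` the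
print-level witness specialises to the sibling file's Galois-quotient witness shape.
([IUTchI] Ex 5.1 (iv) p.126) [claim: Mochizuki2012, status: disputed] -/
example : ∃ β : BirationalData (absoluteGaloisGrp ℚ), β.DecompIsStabilizer :=
  (exists_decompIsStabilizer_of_continuousMonoidHom ℚ (absoluteGaloisGrp ℚ)
    (ContinuousMonoidHom.id _)).imp fun _ h => h.1

end BirationalData

end Literature.IUT.HodgeTheaters

end
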